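import Literature.NumberTheory.GaloisRepresentations.ContinuousShapiroLiftCores
import HarnessLib

/-!
# Vanishing of a Shapiro lift after restriction along a homomorphism `θ : D → G`:
# `θ^*[Sh_N f] = 0` in `H¹(D, Maps(G ⧸ N, X))` as soon as every conjugate local restriction
# `d ↦ f(g⁻¹ θ(d) g)` of `f` is principal (orbit-by-orbit coboundary) — companion of `ContinuousShapiroLift.lean`

Generic continuous group cohomology (no number theory); namespace `Literature.NumberTheory.GaloisRepresentations`.
THEOREMS ONLY (no definition, no named fact, no instance, no `sorry`).

Let `G` be a topological group, `N ≤ G` an open subgroup with coset representatives `s`, `X : TopRep R G`, and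
`f : N → X` a continuous crossed homomorphism with Shapiro lift `F = Sh_N f : G → Maps(G ⧸ N, X)`
(`shapiroCocycle`, `F(g)(y) = s(y) • f(s(y)⁻¹ g s(g⁻¹ y))`). Let `θ : D →ₜ* G` be a continuous homomorphism
(a subgroup inclusion `D ≤ G`, or the restriction `Γ_{K_v} → Γ_K` attached to an embedding `K̄ → K̄_v`). The
double coset formula (Mackey; Brown III (5.6), Neukirch–Schmidt–Wingberg I (1.5.6)) decomposes `θ^* Maps(G ⧸ N, X)` along
the `D`-orbits on `G ⧸ N`, the summand of the orbit of `gN` being induced from `θ⁻¹(gNg⁻¹)` with cocycle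
`d ↦ f(g⁻¹ θ(d) g)`. This file proves the consequence that needs NO decomposition of the module:

* `exists_shapiroCocycle_comp_eq_coboundary` — if for every `g ∈ G` the crossed homomorphism `d ↦ f(g⁻¹ θ(d) g)` on
  `θ⁻¹(gNg⁻¹)` is principal (`= (g⁻¹θ(d)g) • v_g − v_g`), then `F ∘ θ` is a coboundary ON THE NOSE: `F(θ d) = θ(d) ⋆ Φ − Φ` with the
  explicit `Φ(y) = −s(y) • (f(A_y) − A_y • v)`, `A_y = s(y)⁻¹ θ(d_y) s(y₀)`, for base points `y₀` and transporters `d_y`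
  (`θ(d_y) y₀ = y`) of the `D`-orbits on `G ⧸ N` (chosen inside the proof);
* `exists_shapiroCocycle_comp_eq_coboundary_of_reps`, `map_shapiroLift_eq_zero_of_reps` — the same with the hypothesis only at the
  coset representatives `g = s(y₀)` (finitely many conjugates).
* `map_shapiroLift_eq_zero` — hence the class `θ^*[Sh_N f] ∈ H¹(D, θ^* Maps(G ⧸ N, X))` (Mathlib `ContinuousCohomology.map θ (𝟙 _) 1`
  of the tree's `shapiroLift`) vanishes.

Consumer: Poitou–Tate along the layers `ℚ_N` of the cyclotomic `ℤ₂`-tower in the Shapiro model (crux K3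
`SignedKatoDivisibilityUpToAtTwo` of `Summits/BirchSwinnertonDyer`, clause (PT-orth)): for a layer Selmer class `t_N` and a place
`v ∤ 2`, every conjugate local restriction of `t_N` is trivial (`…LayerAwayTrivial`), so the localisation at `v` of the global Shapiro
class `Sh_{Γ_N}^{Γ_ℚ} t_N` vanishes and with it the local term of the reciprocity law at `v`.

## References
* K. S. Brown, *Cohomology of Groups* (1982), III §5 (5.6) (b), III (9.5) (b) (induced modules restricted to a subgroup; Mackey).
  [Brown1982]
* J. Neukirch, A. Schmidt, K. Wingberg, *Cohomology of Number Fields*, 2nd ed. (2008), I §5 (1.5.6)–(1.5.7), I §6 Prop. (1.6.4).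
  [NeukirchSchmidtWingberg2008]
* J.-P. Serre, *Local Fields* (1979), VII §5–§6. [SerreLocalFields1979]
-/

noncomputable section

open CategoryTheory

open scoped Classical

universe u v

namespace Literature.NumberTheory.GaloisRepresentations

open _root_.TopRep
open Literature.NumberTheory.EllipticCurves (schreierElt schreierElt_mem schreierElt_coe rep_mul_schreierElt)

variable {R : Type u} [CommRing R] [TopologicalSpace R]
variable {G : Type v} [Group G] [TopologicalSpace G] [IsTopologicalGroup G]
variable (X : TopRep.{v} R G) (N : Subgroup G) (hN : IsOpen (N : Set G)) {s : G ⧸ N → G}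
variable {D : Type v} [Group D] [TopologicalSpace D] [IsTopologicalGroup D] (θ : D →ₜ* G)

omit [IsTopologicalGroup D] in
/-- **A Shapiro lift restricted along `θ : D → G` is a coboundary on the nose when every conjugate local restriction of the
cocycle is principal.** For `f : N → X` a continuous crossed homomorphism on the open subgroup `N` and `θ : D →ₜ* G`: if for every
`g ∈ G` there is `v_g ∈ X` with `f(g⁻¹ θ(d) g) = (g⁻¹ θ(d) g) • v_g − v_g` whenever `g⁻¹ θ(d) g ∈ N`, then
`Sh_N f (θ d) = θ(d) ⋆ Φ − Φ` for one `Φ ∈ Maps(G ⧸ N, X)` and all `d ∈ D`. Proof: orbit-by-orbit; on the orbit of the base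
point `y₀` with transporters `θ(d_y) y₀ = y` put `A_y = s(y)⁻¹ θ(d_y) s(y₀) ∈ N`; the Schreier element of `(θ d, y)` factors as
`A_y · m · A_{y'}⁻¹` (`y' = θ(d)⁻¹ y`) with `m = s(y₀)⁻¹ θ(h) s(y₀)`, `h = d_y⁻¹ d d_{y'} ∈ Stab(y₀)`, whence
`f(n) = ψ(y) − n • ψ(y')` for `ψ(y) = f(A_y) − A_y • v_{s(y₀)}` and `Φ(y) = −s(y) • ψ(y)` works.
[cite: Brown1982, III (5.6)(b)] [cite: NeukirchSchmidtWingberg2008, I §5 (1.5.6)–(1.5.7)] -/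
theorem exists_shapiroCocycle_comp_eq_coboundary (hs : ∀ x : G ⧸ N, (s x : G ⧸ N) = x)
    (f : contOneCocycles (subgroupRep X N))
    (hloc : ∀ g : G, ∃ v : X, ∀ (d : D) (hd : g⁻¹ * θ d * g ∈ N),
      f.1 ⟨g⁻¹ * θ d * g, hd⟩ = X.ρ (g⁻¹ * θ d * g) v - v) :
    ∃ Φ : coindFin X N, ∀ d : D, (shapiroCocycle X N hN hs f).1 (θ d) = (coindFin X N).ρ (θ d) Φ - Φ := by
  classical
  -- base points of the `D`-orbits on `G ⧸ N` (through `θ`), constant along orbits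
  obtain ⟨base, hbase, hbase_smul⟩ : ∃ base : G ⧸ N → G ⧸ N,
      (∀ y, ∃ d : D, (θ d : G) • base y = y) ∧ ∀ (d : D) (y : G ⧸ N), base ((θ d : G) • y) = base y := by
    have hex : ∀ y : G ⧸ N, ∃ y₀ : G ⧸ N, ∃ d : D, (θ d : G) • y₀ = y := fun y ↦ ⟨y, 1, by simp⟩
    refine ⟨fun y ↦ Classical.epsilon (fun y₀ : G ⧸ N ↦ ∃ d : D, (θ d : G) • y₀ = y),
      fun y ↦ Classical.epsilon_spec (hex y), fun d y ↦ ?_⟩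
    have hpred : (fun y₀ : G ⧸ N ↦ ∃ d' : D, (θ d' : G) • y₀ = (θ d : G) • y) =
        (fun y₀ : G ⧸ N ↦ ∃ d' : D, (θ d' : G) • y₀ = y) := by
      funext y₀
      apply propext
      constructor
      · rintro ⟨d', hd'⟩
        refine ⟨d⁻¹ * d', ?_⟩
        rw [map_mul, map_inv, mul_smul, hd', inv_smul_smul]
      · rintro ⟨d', hd'⟩
        refine ⟨d * d', ?_⟩
        rw [map_mul, mul_smul, hd']
    change Classical.epsilon _ = Classical.epsilon _
    rw [hpred]
  -- transporters `θ(d_y) • base y = y`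
  choose dd hdd using hbase
  -- the trivialising vectors of the conjugate local restrictions
  choose v hv using hloc
  -- `A y = s(y)⁻¹ θ(d_y) s(y₀) ∈ N` (a Schreier element), through its value in `G` only
  obtain ⟨A, hA⟩ : ∃ A : G ⧸ N → N, ∀ y, ((A y : N) : G) = (s y)⁻¹ * θ (dd y) * s (base y) := by
    refine ⟨fun y ↦ schreierElt N hs (θ (dd y) : G) (base y), fun y ↦ ?_⟩
    change ((schreierElt N hs (θ (dd y) : G) (base y) : N) : G) = _
    rw [schreierElt_coe, hdd]
  obtain ⟨ψ, hψ⟩ : ∃ ψ : G ⧸ N → X, ∀ y, ψ y = f.1 (A y) - X.ρ ((A y : N) : G) (v (s (base y))) :=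
    ⟨_, fun _ ↦ rfl⟩
  refine ⟨fun y ↦ -X.ρ (s y) (ψ y), fun d ↦ funext fun y ↦ ?_⟩
  rw [shapiroCocycle_apply, coindFin_sub_apply, coindFin_ρ_apply]
  -- `y' = θ(d)⁻¹ • y` and the Schreier element `n = s(y)⁻¹ θ(d) s(y')`
  obtain ⟨y', hy'⟩ : ∃ y' : G ⧸ N, y' = (θ d : G)⁻¹ • y := ⟨_, rfl⟩
  obtain ⟨n, hn⟩ : ∃ n : N, n = schreierElt N hs (θ d : G) ((θ d : G)⁻¹ • y) := ⟨_, rfl⟩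
  rw [← hn, ← hy']
  show X.ρ (s y) (f.1 n) = X.ρ (θ d : G) (-X.ρ (s y') (ψ y')) - -X.ρ (s y) (ψ y)
  have hyy' : (θ d : G) • y' = y := by rw [hy', smul_inv_smul]
  have hbase' : base y' = base y := by rw [← hbase_smul d y', hyy']
  have hncoe : ((n : N) : G) = (s y)⁻¹ * θ d * s y' := by rw [hn, schreierElt_coe, ← hy', hyy']
  have hsn : s y * (n : G) = θ d * s y' := by rw [hncoe, ← mul_assoc, ← mul_assoc, mul_inv_cancel, one_mul]
  -- `m := A_y⁻¹ n A_{y'} = s(y₀)⁻¹ θ(h) s(y₀)` with `h := d_y⁻¹ d d_{y'}` stabilising `y₀ = base y`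
  obtain ⟨h, hh⟩ : ∃ h : D, h = (dd y)⁻¹ * d * dd y' := ⟨_, rfl⟩
  obtain ⟨m, hm⟩ : ∃ m : N, m = (A y)⁻¹ * n * A y' := ⟨_, rfl⟩
  have hmcoe : ((m : N) : G) = (s (base y))⁻¹ * θ h * s (base y) := by
    rw [hm, Subgroup.coe_mul, Subgroup.coe_mul, Subgroup.coe_inv, hA, hA, hncoe, hbase', hh, map_mul, map_mul,
      map_inv]
    group
  have hmN : (s (base y))⁻¹ * θ h * s (base y) ∈ N := by rw [← hmcoe]; exact SetLike.coe_mem _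
  have hfm : f.1 m = X.ρ ((m : N) : G) (v (s (base y))) - v (s (base y)) := by
    have e : m = ⟨(s (base y))⁻¹ * θ h * s (base y), hmN⟩ := Subtype.ext hmcoe
    rw [e]
    exact hv (s (base y)) h hmN
  -- `n = A_y · (m · A_{y'}⁻¹)` and `A_y · m = n · A_{y'}`
  have hnfac : n = A y * (m * (A y')⁻¹) := by rw [hm]; group
  have hAm : ((A y : N) : G) * (m : G) = (n : G) * (A y' : G) := by
    rw [hm, Subgroup.coe_mul, Subgroup.coe_mul, Subgroup.coe_inv]; group
  -- Step 1: `f(n) = ψ(y) − n • ψ(y')`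
  have step1 : f.1 n = ψ y - X.ρ ((n : N) : G) (ψ y') := by
    have h1 : f.1 n = f.1 (A y) + X.ρ ((A y : N) : G) (f.1 m + X.ρ ((m : N) : G) (f.1 (A y')⁻¹)) := by
      conv_lhs => rw [hnfac]
      rw [subgroup_cocycle_mul, subgroup_cocycle_mul]
    have h2 : X.ρ ((A y : N) : G) (X.ρ ((m : N) : G) (X.ρ (((A y' : N) : G)⁻¹) (f.1 (A y')))) =
        X.ρ ((n : N) : G) (f.1 (A y')) := by
      rw [← ρ_mul_apply, ← ρ_mul_apply, hAm, mul_assoc, mul_inv_cancel, mul_one]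
    have h3 : X.ρ ((A y : N) : G) (X.ρ ((m : N) : G) (v (s (base y)))) =
        X.ρ ((n : N) : G) (X.ρ ((A y' : N) : G) (v (s (base y)))) := by
      rw [← ρ_mul_apply, ← ρ_mul_apply, hAm]
    rw [h1, hfm, subgroup_cocycle_inv]
    simp only [map_add, map_sub, map_neg]
    rw [h2, h3, hψ y, hψ y', hbase', map_sub]
    abel
  -- Step 2: assemble `F(θ d)(y) = θ(d) • Φ(y') − Φ(y)`
  rw [step1, map_sub, ← ρ_mul_apply X (s y) ((n : N) : G), hsn, ρ_mul_apply, map_neg]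
  abel

/-- **Vanishing of the restricted Shapiro class.** Under the hypothesis of `exists_shapiroCocycle_comp_eq_coboundary`, the restriction
along `θ` of the Shapiro class, `θ^*(Sh_N [f]) ∈ H¹(D, θ^* Maps(G ⧸ N, X))` (Mathlib `ContinuousCohomology.map θ (𝟙 _) 1` applied to the
tree's `shapiroLift`), is zero. For `θ` the inclusion of a decomposition group this is the vanishing of a local term of Poitou–Tate in the
Shapiro model. [cite: Brown1982, III (5.6)(b)] [cite: NeukirchSchmidtWingberg2008, I §6 Prop. (1.6.4)] -/
theorem map_shapiroLift_eq_zero [Fintype (G ⧸ N)] (hs : ∀ x : G ⧸ N, (s x : G ⧸ N) = x) (hs1 : s ((1 : G) : G ⧸ N) = 1)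
    (f : contOneCocycles (subgroupRep X N))
    (hloc : ∀ g : G, ∃ v : X, ∀ (d : D) (hd : g⁻¹ * θ d * g ∈ N),
      f.1 ⟨g⁻¹ * θ d * g, hd⟩ = X.ρ (g⁻¹ * θ d * g) v - v) :
    ContinuousCohomology.map θ (𝟙 (TopRep.res (θ : D →* G) (coindFin X N))) 1
        (shapiroLift X N hN hs hs1 (oneCocycleClass _ f)) = 0 := by
  have e1 := congrArg (ContinuousCohomology.map θ (𝟙 (TopRep.res (θ : D →* G) (coindFin X N))) 1)
    (shapiroLift_oneCocycleClass X N hN hs hs1 f)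
  have e2 := map_oneCocycleClass (coindFin X N) (Y := TopRep.res (θ : D →* G) (coindFin X N)) θ
    (𝟙 (TopRep.res (θ : D →* G) (coindFin X N))) (shapiroCocycle X N hN hs f)
  refine e1.trans (e2.trans ?_)
  rw [oneCocycleClass_eq_zero_iff]
  obtain ⟨Φ, hΦ⟩ := exists_shapiroCocycle_comp_eq_coboundary X N hN θ hs f hloc
  refine ⟨Φ, fun d ↦ ?_⟩
  rw [contOneCocycles.pullback_apply]
  exact hΦ d

omit [IsTopologicalGroup D] in
/-- **The same, with the hypothesis only at the chosen coset representatives** (a WEAKER hypothesis: the proof of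
`exists_shapiroCocycle_comp_eq_coboundary` uses the principal vectors `v_g` only at `g = s(y₀)`): if for every coset `y₀ ∈ G ⧸ N` there is
`v ∈ X` with `f(s(y₀)⁻¹ θ(d) s(y₀)) = (s(y₀)⁻¹ θ(d) s(y₀)) • v − v` whenever `s(y₀)⁻¹ θ(d) s(y₀) ∈ N`, then `Sh_N f ∘ θ` is a coboundary on
the nose. This is the form consumed when the principal vectors must lie in a prescribed finite submodule uniformly — only FINITELY MANY
conjugates (`|G ⧸ N|` of them) are involved. [cite: Brown1982, III (5.6)(b)] [cite: NeukirchSchmidtWingberg2008, I §5 (1.5.6)–(1.5.7)] -/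
theorem exists_shapiroCocycle_comp_eq_coboundary_of_reps (hs : ∀ x : G ⧸ N, (s x : G ⧸ N) = x)
    (f : contOneCocycles (subgroupRep X N))
    (hloc : ∀ y₀ : G ⧸ N, ∃ v : X, ∀ (d : D) (hd : (s y₀)⁻¹ * θ d * s y₀ ∈ N),
      f.1 ⟨(s y₀)⁻¹ * θ d * s y₀, hd⟩ = X.ρ ((s y₀)⁻¹ * θ d * s y₀) v - v) :
    ∃ Φ : coindFin X N, ∀ d : D, (shapiroCocycle X N hN hs f).1 (θ d) = (coindFin X N).ρ (θ d) Φ - Φ := by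
  classical
  -- base points of the `D`-orbits on `G ⧸ N` (through `θ`), constant along orbits
  obtain ⟨base, hbase, hbase_smul⟩ : ∃ base : G ⧸ N → G ⧸ N,
      (∀ y, ∃ d : D, (θ d : G) • base y = y) ∧ ∀ (d : D) (y : G ⧸ N), base ((θ d : G) • y) = base y := by
    have hex : ∀ y : G ⧸ N, ∃ y₀ : G ⧸ N, ∃ d : D, (θ d : G) • y₀ = y := fun y ↦ ⟨y, 1, by simp⟩
    refine ⟨fun y ↦ Classical.epsilon (fun y₀ : G ⧸ N ↦ ∃ d : D, (θ d : G) • y₀ = y),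
      fun y ↦ Classical.epsilon_spec (hex y), fun d y ↦ ?_⟩
    have hpred : (fun y₀ : G ⧸ N ↦ ∃ d' : D, (θ d' : G) • y₀ = (θ d : G) • y) =
        (fun y₀ : G ⧸ N ↦ ∃ d' : D, (θ d' : G) • y₀ = y) := by
      funext y₀
      apply propext
      constructor
      · rintro ⟨d', hd'⟩
        refine ⟨d⁻¹ * d', ?_⟩
        rw [map_mul, map_inv, mul_smul, hd', inv_smul_smul]
      · rintro ⟨d', hd'⟩
        refine ⟨d * d', ?_⟩
        rw [map_mul, mul_smul, hd']
    change Classical.epsilon _ = Classical.epsilon _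
    rw [hpred]
  -- transporters `θ(d_y) • base y = y`
  choose dd hdd using hbase
  -- the trivialising vectors of the conjugate local restrictions
  choose v hv using hloc
  -- `A y = s(y)⁻¹ θ(d_y) s(y₀) ∈ N` (a Schreier element), through its value in `G` only
  obtain ⟨A, hA⟩ : ∃ A : G ⧸ N → N, ∀ y, ((A y : N) : G) = (s y)⁻¹ * θ (dd y) * s (base y) := by
    refine ⟨fun y ↦ schreierElt N hs (θ (dd y) : G) (base y), fun y ↦ ?_⟩
    change ((schreierElt N hs (θ (dd y) : G) (base y) : N) : G) = _
    rw [schreierElt_coe, hdd]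
  obtain ⟨ψ, hψ⟩ : ∃ ψ : G ⧸ N → X, ∀ y, ψ y = f.1 (A y) - X.ρ ((A y : N) : G) (v (base y)) :=
    ⟨_, fun _ ↦ rfl⟩
  refine ⟨fun y ↦ -X.ρ (s y) (ψ y), fun d ↦ funext fun y ↦ ?_⟩
  rw [shapiroCocycle_apply, coindFin_sub_apply, coindFin_ρ_apply]
  -- `y' = θ(d)⁻¹ • y` and the Schreier element `n = s(y)⁻¹ θ(d) s(y')`
  obtain ⟨y', hy'⟩ : ∃ y' : G ⧸ N, y' = (θ d : G)⁻¹ • y := ⟨_, rfl⟩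
  obtain ⟨n, hn⟩ : ∃ n : N, n = schreierElt N hs (θ d : G) ((θ d : G)⁻¹ • y) := ⟨_, rfl⟩
  rw [← hn, ← hy']
  show X.ρ (s y) (f.1 n) = X.ρ (θ d : G) (-X.ρ (s y') (ψ y')) - -X.ρ (s y) (ψ y)
  have hyy' : (θ d : G) • y' = y := by rw [hy', smul_inv_smul]
  have hbase' : base y' = base y := by rw [← hbase_smul d y', hyy']
  have hncoe : ((n : N) : G) = (s y)⁻¹ * θ d * s y' := by rw [hn, schreierElt_coe, ← hy', hyy']
  have hsn : s y * (n : G) = θ d * s y' := by rw [hncoe, ← mul_assoc, ← mul_assoc, mul_inv_cancel, one_mul]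
  -- `m := A_y⁻¹ n A_{y'} = s(y₀)⁻¹ θ(h) s(y₀)` with `h := d_y⁻¹ d d_{y'}` stabilising `y₀ = base y`
  obtain ⟨h, hh⟩ : ∃ h : D, h = (dd y)⁻¹ * d * dd y' := ⟨_, rfl⟩
  obtain ⟨m, hm⟩ : ∃ m : N, m = (A y)⁻¹ * n * A y' := ⟨_, rfl⟩
  have hmcoe : ((m : N) : G) = (s (base y))⁻¹ * θ h * s (base y) := by
    rw [hm, Subgroup.coe_mul, Subgroup.coe_mul, Subgroup.coe_inv, hA, hA, hncoe, hbase', hh, map_mul, map_mul,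
      map_inv]
    group
  have hmN : (s (base y))⁻¹ * θ h * s (base y) ∈ N := by rw [← hmcoe]; exact SetLike.coe_mem _
  have hfm : f.1 m = X.ρ ((m : N) : G) (v (base y)) - v (base y) := by
    have e : m = ⟨(s (base y))⁻¹ * θ h * s (base y), hmN⟩ := Subtype.ext hmcoe
    rw [e]
    exact hv (base y) h hmN
  -- `n = A_y · (m · A_{y'}⁻¹)` and `A_y · m = n · A_{y'}`
  have hnfac : n = A y * (m * (A y')⁻¹) := by rw [hm]; group
  have hAm : ((A y : N) : G) * (m : G) = (n : G) * (A y' : G) := by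
    rw [hm, Subgroup.coe_mul, Subgroup.coe_mul, Subgroup.coe_inv]; group
  -- Step 1: `f(n) = ψ(y) − n • ψ(y')`
  have step1 : f.1 n = ψ y - X.ρ ((n : N) : G) (ψ y') := by
    have h1 : f.1 n = f.1 (A y) + X.ρ ((A y : N) : G) (f.1 m + X.ρ ((m : N) : G) (f.1 (A y')⁻¹)) := by
      conv_lhs => rw [hnfac]
      rw [subgroup_cocycle_mul, subgroup_cocycle_mul]
    have h2 : X.ρ ((A y : N) : G) (X.ρ ((m : N) : G) (X.ρ (((A y' : N) : G)⁻¹) (f.1 (A y')))) =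
        X.ρ ((n : N) : G) (f.1 (A y')) := by
      rw [← ρ_mul_apply, ← ρ_mul_apply, hAm, mul_assoc, mul_inv_cancel, mul_one]
    have h3 : X.ρ ((A y : N) : G) (X.ρ ((m : N) : G) (v (base y))) =
        X.ρ ((n : N) : G) (X.ρ ((A y' : N) : G) (v (base y))) := by
      rw [← ρ_mul_apply, ← ρ_mul_apply, hAm]
    rw [h1, hfm, subgroup_cocycle_inv]
    simp only [map_add, map_sub, map_neg]
    rw [h2, h3, hψ y, hψ y', hbase', map_sub]
    abel
  -- Step 2: assemble `F(θ d)(y) = θ(d) • Φ(y') − Φ(y)`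
  rw [step1, map_sub, ← ρ_mul_apply X (s y) ((n : N) : G), hsn, ρ_mul_apply, map_neg]
  abel


/-- **Vanishing of the restricted Shapiro class, hypothesis at the coset representatives only.**
[cite: Brown1982, III (5.6)(b)] [cite: NeukirchSchmidtWingberg2008, I §6 Prop. (1.6.4)] -/
theorem map_shapiroLift_eq_zero_of_reps [Fintype (G ⧸ N)] (hs : ∀ x : G ⧸ N, (s x : G ⧸ N) = x) (hs1 : s ((1 : G) : G ⧸ N) = 1)
    (f : contOneCocycles (subgroupRep X N))
    (hloc : ∀ y₀ : G ⧸ N, ∃ v : X, ∀ (d : D) (hd : (s y₀)⁻¹ * θ d * s y₀ ∈ N),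
      f.1 ⟨(s y₀)⁻¹ * θ d * s y₀, hd⟩ = X.ρ ((s y₀)⁻¹ * θ d * s y₀) v - v) :
    ContinuousCohomology.map θ (𝟙 (TopRep.res (θ : D →* G) (coindFin X N))) 1
        (shapiroLift X N hN hs hs1 (oneCocycleClass _ f)) = 0 := by
  have e1 := congrArg (ContinuousCohomology.map θ (𝟙 (TopRep.res (θ : D →* G) (coindFin X N))) 1)
    (shapiroLift_oneCocycleClass X N hN hs hs1 f)
  have e2 := map_oneCocycleClass (coindFin X N) (Y := TopRep.res (θ : D →* G) (coindFin X N)) θ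
    (𝟙 (TopRep.res (θ : D →* G) (coindFin X N))) (shapiroCocycle X N hN hs f)
  refine e1.trans (e2.trans ?_)
  rw [oneCocycleClass_eq_zero_iff]
  obtain ⟨Φ, hΦ⟩ := exists_shapiroCocycle_comp_eq_coboundary_of_reps X N hN θ hs f hloc
  refine ⟨Φ, fun d ↦ ?_⟩
  rw [contOneCocycles.pullback_apply]
  exact hΦ d

end Literature.NumberTheory.GaloisRepresentations

end
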